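/-
Copyright (c) 2026 the pub-hodgecm-mathlib formalisation cell (harness21).  Prover seat hodgecm-mathlib-LH4-p04 (g4), req620 Track A «(D-RAM) FOUR-FRAME» squad
(unit U2H_HSide, the (ρ2b′-X) payer road; payer LH4-p14 (g4) hand (C4) «T5s-RamK ∕ RamM» 05:05:59Z, dealer LH4-plan (g12) WORD #27; letters of record = LH4-p06 (g4) T5c «TORIC
LEVEL CENSUS, M∕E-RAMIFIED» ★ p857497∕p857535∕p857549 + ★ p857465 `QuadraticOrderNormDepthIndexTwoRamified` + this seat's CLASS MODEL (validated against F0P3a-p01 (g32)'s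
E1 rows: u-free 5524∕5524, depth 5206∕5206 + 284∕284 one-sided top cells off the FLIP rows); heir LEAD F0P3a-plan (g20) T19-05 (1) «class-keyed level letter»).  2026-09-04.
-/
import Summits.HodgeConjecture.HodgeConjecture.Theorems.F0P3cDyRamToricCensusSumRamKParts   -- ★ p857624 (this seat): `genBlock_mul`, `topBlock_mul`; brings ★ p857321's re-indexing tools
import Mathlib.Algebra.Ring.GeomSum
import HarnessLib

/-!
# Crux `H413`, line LH4 «(D-RAM) FOUR-FRAME» road — unit U2H (ii-H), the (ρ2b′-X) payer: O-Sum ∕ T5s «TORIC CENSUS SUM», TYPE RamM («E, K, K♮ ALL RAMIFIED OVER F») —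
# FILE 1∕2 «PARTS»: the difference of the two u-free RamM tables, the cells and the columns of the difference census

Cell `hodgecm-mathlib` (D-0151), FLOOR 0, crux item H413 = `stmt-HodgeConjecture-24833`, route of record `HCCMUnconditional`; squad F0∕P3c∕LH4 (req618∕req620); registered stub
served: `F0P3cDyRamFourFrameU2H.stub_U2H_fixedPointCensus_typeTwo_unit0` ((ρ2b′-X), tree `Cruxes/H413/Lines/F0_P3c_DyRamFourFrame_U2H_HSide.lean` :418), organ O-Sum ∕ T5s
(payer lineage LH4-p14, HEAD-OF-ORGANS MAP v1 seam S7 «RK∕RM twins»), type RamM = the totally ramified biquadratic case (`M∕E`, `M∕K♮`, `M∕K` ramified with conductor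
exponents `d_ρ, dΘ, dτ`; `d_ρ + 2d_E = dΘ + 2d′ = dτ + 2d_K = d_E + d_K + d′`).  THEOREMS ONLY (no `def`, no instance, no notation, no `sorry`, default heartbeats); lane
`--supports stmt-HodgeConjecture-24833 --as helper` (count-neutral).  Pure finite-sum bookkeeping over `ℚ` — no lattices, no fields.

PARAMETERS `g := dΘ∕2` (the index threshold `dΘ ≤ k+1` of ★ p857465, = the RM level letter `2n_H = jl − g`) and `s0 := dτ∕2` (the E-level shift of the K♮-level
`k = (j − a) − s0`, ★ p857549's bookkeeping `2(d′ + k) + 2a = 2j + d_ρ`); `d_E = g + s0`.  LETTERS (ℕ-valued `if-then-else`, cast to `ℚ`) = THE CLASS MODEL: the class of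
`−η_s·t(α)^{k₀}` in `T♮∕T_N` (order 4) alternates with the parity of `k`: `k` odd ⇒ the ODD coset (constant ρ-depth `d′ − 1`: ONE cell `k = −1` of mass `q^j` on both sides,
nothing at the other odd levels); `k` even ⇒ on `+` the TRANSLATOR class (★ p857549 §4∕§5 `q^j∕I(k) − q^j∕I(k+1)`: `(q−1)q^{j−1−k∕2} ∣ (q−2)q^{j−1−k∕2} ∣ 2(q−1)q^{j−1−k∕2}` on
`k + 2 <, =, > 2g`; cumulative row `a = 0`: `(1∣2)·q^{j−k∕2}`), on `−` the NON-NORM even class (`(q−1)q^{j−1−k∕2} ∣ q^{j−k∕2} ∣ 0`; row `a = 0`: `q^{j−k∕2}·[k ≤ 2g−2]`); below `k < 0`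
every class is whole.  Their DIFFERENCE (`tables_diff_ramM`) is the RamK shape in the shifted level: `2q^{j−k∕2}` (`a = 0`, `k ≥ 2g`), `−2q^{j−1−k∕2}` (`k = 2g−2`), `2(q−1)q^{j−1−k∕2}`
(`k ≥ 2g`), `0` elsewhere.  DEPTH RULES at the tokens `(m, ε)` (`|μ| = |ϖE|^m`, ★ p857535): (D1)(D2) GENERIC cells `a ≤ m ∧ (j + a ≤ m ∨ (2a ≤ m ∧ j + a ≤ jl))` whole, the other
off-diagonal cells empty; (D3) the diagonal `j + m = jl + a` top cells are worth `q^j∕I(k′)`, `k′ = j + a − m − s0` (`q^j` for `k′ < 0`, `(1∣2)·q^{j−⌈k′∕2⌉}` beyond), ALIVE iff the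
bit `2j + d_E ≤ 2jl + 1` holds (Φ-mechanism with `M∕K` ramified of lower break `dτ − 1`: `D = 4n_H + 1 + d_ρ − (dτ − 1)`) and — beyond the threshold `k′ ≥ 2g − 1` — only on
the side of the norm class `ε`; below it both sides are alive and CANCEL.  Every one of these letters was checked against F0P3a-p01 (g32)'s E1 rows (eME = 2, 135 (λ,u)-rows,
cells (g,s0) = (1,1), (1,1), (2,1), (1,2)): u-free 5524∕5524, GEN 2734∕2734, off-diagonal 2066∕2066, dead-by-bit 266∕266, both-alive 140∕140, one-sided = ε-side 284∕284 on the
non-FLIP rows.  ORGAN GAP (named, not mine): ★ p857549∕p857385 count RamM level sets GIVEN A UNIT TRANSLATOR (class T); the odd class and the non-norm even class (the whole `−`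
table and the `k = −1` row of `+`) still want their ★ organ — until then they are hypotheses of FILE 2's head like every other letter.
CONTENT.  `tables_diff_ramM`; `col_zero_ramM` (the column `a = 0`: `2x^{g+s0}·[⌊(jl−s0)∕2⌋ + 1 − g]_x`); `cell_pos_ramM` ∕ `col_pos_ramM` (a column `a ≥ 1`: generic ray
`j = a + s0 + 2k`, worth `2x^{⌊(jl+s0)∕2⌋+a} − 2(x+1)x^{2a+d_E−2}` iff `2a ≤ m ∧ 2g + 2a + s0 ≤ jl + 2`, plus the one-sided top cell `ε·2x^{⌊(jl+s0)∕2⌋+a}` iff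
`m < 2a ∧ 2a + d_E ≤ 2m + 1 ∧ 2m + 2g + s0 ≤ jl + 2a + 1`); the geometric blocks are ★ p857624's `genBlock_mul ∕ topBlock_mul`.
HONEST LABEL.  Count-neutral (`--supports`); nothing printed is asserted; (ρ2b′-X) `stub_U2H_fixedPointCensus_typeTwo_unit0` (U2H :418) stays a PROVER TARGET (an empirical
census law, kit-confirmed; (R-25): organ road measured at `tE = 2`) until its payer lands; `HC_CM` is proved only modulo the 7 printed citations (2 remaining named inputs: hLiu418 =
`stmt-HodgeConjecture-24832`, h413 = `stmt-HodgeConjecture-24833`) until rung 0 closes.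

## References
* [Kottwitz1986BaseChangeUnits] R. E. Kottwitz, *Base change for unit elements of Hecke algebras*, Compositio Math. 60 (1986), §1 pp. 240–241 (orbital integrals of units as
  lattice counts modulo the torus).
* [Rogawski1990] J. D. Rogawski, *Automorphic Representations of Unitary Groups in Three Variables*, Ann. of Math. Stud. 123 (1990), §4.9 Prop. 4.9.1 (b) p. 55, Lemma 4.9.3 p. 56
  (the fixed-point census of a type-(2) element; the toric decomposition).
* [Flicker1998UnitaryFL] Y. Z. Flicker, *Elementary proof of the fundamental lemma for a unitary group*, Canad. J. Math. 50 (1998): Prop. 7 p. 84, §6 p. 95 REMARK (Mars).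
* [Serre1979] J.-P. Serre, *Local Fields*, GTM 67 (1979): Ch. V §3 Cor. 3 (norm groups of the unit filtration; the Hasse–Herbrand break).
-/

set_option autoImplicit false

namespace Summit.HodgeConjecture.HodgeConjecture.Cruxes.H413.F0P3cDyRamToricCensusSumRamMParts

open Finset
open Summit.HodgeConjecture.HodgeConjecture.Cruxes.H413.F0P3cDyRamToricCensusSumUnrBlocks (sum_range_parity_reindex sum_range_window_reindex geom_sum_mul' geom_sum_two_mul)
open Summit.HodgeConjecture.HodgeConjecture.Cruxes.H413.F0P3cDyRamToricCensusSumRamKParts (genBlock_mul topBlock_mul)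

/-- **THE DIFFERENCE OF THE TWO u-FREE RamM TABLES** (class model, cast to `ℚ`; `k = (j − a) − s0` the K♮-level): the odd-coset cell `k = −1` (`q^j` on both sides) and the
shallow cells cancel; on the even levels `k ≥ 0` the difference is `2q^{j−k∕2}` on the cumulative row `a = 0`, `k ≥ 2g`; `−2q^{j−1−k∕2}` at `k = 2g−2`; `2(q−1)q^{j−1−k∕2}` for `k ≥ 2g`
(`a ≥ 1`) — the group form `q^j·([k ≥ 2g−1]∕I(k) − [a ≥ 1][k+1 ≥ 2g−1]∕I(k+1))·2`. [folklore] -/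
theorem tables_diff_ramM (q : ℕ) (hq : 2 ≤ q) {g s0 : ℕ} (hg : 1 ≤ g) (j a : ℕ) :
    ((if j = 0 then (if a = 0 then 1 else 0) else if j < a then 0
      else if j - a + 1 = s0 then q ^ j else if j - a + 1 < s0 then (if a = 0 then q ^ j else 0) else if (j - a - s0) % 2 = 1 then 0
      else if a = 0 then (if 2 * g ≤ j - a - s0 then 2 else 1) * q ^ (j - (j - a - s0) / 2)
      else if j - a - s0 + 2 < 2 * g then (q - 1) * q ^ (j - 1 - (j - a - s0) / 2) else if j - a - s0 + 2 = 2 * g then (q - 2) * q ^ (j - 1 - (j - a - s0) / 2)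
      else 2 * (q - 1) * q ^ (j - 1 - (j - a - s0) / 2) : ℕ) : ℚ) -
    ((if j = 0 then (if a = 0 then 1 else 0) else if j < a then 0
      else if j - a + 1 = s0 then q ^ j else if j - a + 1 < s0 then (if a = 0 then q ^ j else 0) else if (j - a - s0) % 2 = 1 then 0
      else if a = 0 then (if j - a - s0 + 2 ≤ 2 * g then q ^ (j - (j - a - s0) / 2) else 0)
      else if j - a - s0 + 2 < 2 * g then (q - 1) * q ^ (j - 1 - (j - a - s0) / 2) else if j - a - s0 + 2 = 2 * g then q ^ (j - (j - a - s0) / 2) else 0 : ℕ) : ℚ) =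
    if a + s0 ≤ j ∧ (j - (a + s0)) % 2 = 0 then
      (if a = 0 then (if 2 * g ≤ j - s0 then 2 * (q : ℚ) ^ (j - (j - s0) / 2) else 0)
       else (if j - a - s0 + 2 = 2 * g then -2 * (q : ℚ) ^ (j - 1 - (j - a - s0) / 2)
         else if 2 * g < j - a - s0 + 2 then 2 * ((q : ℚ) - 1) * (q : ℚ) ^ (j - 1 - (j - a - s0) / 2) else 0))
    else 0 := by
  have hq1 : ((q - 1 : ℕ) : ℚ) = (q : ℚ) - 1 := by rw [Nat.cast_sub (by omega)]; norm_num
  have hq2 : ((q - 2 : ℕ) : ℚ) = (q : ℚ) - 2 := by rw [Nat.cast_sub (by omega)]; norm_num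
  rcases Nat.eq_zero_or_pos j with rfl | hj
  · -- `j = 0`
    by_cases ha : a = 0
    · subst ha
      rw [if_pos rfl, if_pos rfl, if_pos rfl, if_pos rfl, sub_self]
      by_cases h : 0 + s0 ≤ 0 ∧ (0 - (0 + s0)) % 2 = 0
      · rw [if_pos h, if_neg (show ¬ 2 * g ≤ 0 - s0 by omega)]
      · rw [if_neg h]
    · rw [if_pos rfl, if_neg ha, if_pos rfl, if_neg ha, if_neg (fun h => ha (by omega))]; simp
  have hj0 : j ≠ 0 := by omega
  rw [if_neg hj0, if_neg hj0]
  by_cases hlt : j < a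
  · rw [if_pos hlt, if_pos hlt, if_neg (fun h => by omega)]; simp
  rw [if_neg hlt, if_neg hlt]
  by_cases hO : j - a + 1 = s0
  · rw [if_pos hO, if_pos hO, if_neg (fun h => by omega)]; simp
  rw [if_neg hO, if_neg hO]
  by_cases hsh : j - a + 1 < s0
  · rw [if_pos hsh, if_pos hsh, if_neg (show ¬ (a + s0 ≤ j ∧ (j - (a + s0)) % 2 = 0) by omega)]
    split_ifs <;> simp
  rw [if_neg hsh, if_neg hsh]
  by_cases hodd : (j - a - s0) % 2 = 1
  · rw [if_pos hodd, if_pos hodd, if_neg (fun h => by omega)]; simp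
  rw [if_neg hodd, if_neg hodd, if_pos (show a + s0 ≤ j ∧ (j - (a + s0)) % 2 = 0 by omega)]
  by_cases ha0 : a = 0
  · subst ha0
    rw [if_pos rfl, if_pos rfl, if_pos rfl, Nat.sub_zero]
    by_cases h2 : 2 * g ≤ j - s0
    · rw [if_pos h2, if_neg (show ¬ j - s0 + 2 ≤ 2 * g by omega), if_pos h2]; push_cast; ring
    · rw [if_neg h2, if_pos (show j - s0 + 2 ≤ 2 * g by omega), if_neg h2]; push_cast; ring
  rw [if_neg ha0, if_neg ha0, if_neg ha0]
  by_cases hlow : j - a - s0 + 2 < 2 * g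
  · rw [if_pos hlow, if_pos hlow, if_neg (by omega), if_neg (by omega)]; push_cast; ring
  rw [if_neg hlow, if_neg hlow]
  by_cases heq : j - a - s0 + 2 = 2 * g
  · rw [if_pos heq, if_pos heq, if_pos heq]
    have e : j - (j - a - s0) / 2 = (j - 1 - (j - a - s0) / 2) + 1 := by omega
    push_cast; rw [hq2, e, pow_succ]; ring
  · rw [if_neg heq, if_neg heq, if_neg heq, if_pos (by omega)]; push_cast; rw [hq1]; ring


/-- **THE COLUMN `a = 0`** of the RamM difference census: every cell is generic, and `n₊(j,0) − n₋(j,0) = 2q^{j − k∕2}` exactly on the even K♮-levels `k = j − s0 ≥ 2g`;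
so the column sums to `2x^{s0+g}·[⌊(jl − s0)∕2⌋ + 1 − g]_x`. [folklore] -/
theorem col_zero_ramM (x : ℚ) {g s0 jl m : ℕ} (hg : 1 ≤ g) (nP nM vP vM : ℕ → ℕ → ℚ)
    (hδ : ∀ j a, nP j a - nM j a = if a + s0 ≤ j ∧ (j - (a + s0)) % 2 = 0 then
      (if a = 0 then (if 2 * g ≤ j - s0 then 2 * x ^ (j - (j - s0) / 2) else 0)
       else (if j - a - s0 + 2 = 2 * g then -2 * x ^ (j - 1 - (j - a - s0) / 2)
         else if 2 * g < j - a - s0 + 2 then 2 * (x - 1) * x ^ (j - 1 - (j - a - s0) / 2) else 0)) else 0)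
    (hvGen : ∀ j a, (a ≤ m ∧ (j + a ≤ m ∨ (2 * a ≤ m ∧ j + a ≤ jl))) → vP j a = nP j a ∧ vM j a = nM j a) :
    ∑ j ∈ range (jl + 1), x ^ 0 * (vP j 0 - vM j 0) = 2 * x ^ (g + s0) * ∑ k ∈ range ((jl - s0) / 2 + 1 - g), x ^ k := by
  have hcell : ∀ j ∈ range (jl + 1), x ^ 0 * (vP j 0 - vM j 0) = if s0 + 2 * g ≤ j ∧ (j - (s0 + 2 * g)) % 2 = 0 then 2 * x ^ (j - (j - s0) / 2) else 0 := by
    intro j hj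
    rw [Finset.mem_range] at hj
    obtain ⟨hP, hM⟩ := hvGen j 0 ⟨Nat.zero_le _, Or.inr ⟨by omega, by omega⟩⟩
    rw [pow_zero, one_mul, hP, hM, hδ, if_pos rfl]
    by_cases h : s0 + 2 * g ≤ j ∧ (j - (s0 + 2 * g)) % 2 = 0
    · rw [if_pos h, if_pos (show 0 + s0 ≤ j ∧ (j - (0 + s0)) % 2 = 0 by omega), if_pos (show 2 * g ≤ j - s0 by omega)]
    · rw [if_neg h]
      by_cases h' : 0 + s0 ≤ j ∧ (j - (0 + s0)) % 2 = 0
      · rw [if_pos h', if_neg (show ¬ 2 * g ≤ j - s0 by omega)]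
      · rw [if_neg h']
  rw [Finset.sum_congr rfl hcell, sum_range_parity_reindex (fun j => 2 * x ^ (j - (j - s0) / 2)) (s0 + 2 * g) jl, Finset.mul_sum]
  rw [show (jl + 2 - (s0 + 2 * g)) / 2 = (jl - s0) / 2 + 1 - g by omega]
  refine Finset.sum_congr rfl fun u _ => ?_
  rw [show s0 + 2 * g + 2 * u - (s0 + 2 * g + 2 * u - s0) / 2 = (g + s0) + u by omega, pow_add]; ring

/-- **ONE CELL OF A COLUMN `a ≥ 1`** of the RamM difference census `x^a·(v₊ − v₋)(j,a)`: a generic cell carries `x^a·(n₊ − n₋)(j,a)` (K♮-parity ray `j ≡ a + s0`), an off-diagonal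
non-generic cell nothing, and the diagonal top cell `j + m = jl + a` carries `ε·2x^{⌊(jl+s0)∕2⌋+a}` exactly when it is alive on one side only (`2j + d_E ≤ 2jl + 1`, `k′ ≥ 2g − 1`). [folklore] -/
theorem cell_pos_ramM (x ε : ℚ) (hε : ε = 1 ∨ ε = -1) {g s0 jl m : ℕ} (hg : 1 ≤ g) (hm : m ≤ jl) (nP nM vP vM : ℕ → ℕ → ℚ)
    (hδ : ∀ j a, nP j a - nM j a = if a + s0 ≤ j ∧ (j - (a + s0)) % 2 = 0 then
      (if a = 0 then (if 2 * g ≤ j - s0 then 2 * x ^ (j - (j - s0) / 2) else 0)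
       else (if j - a - s0 + 2 = 2 * g then -2 * x ^ (j - 1 - (j - a - s0) / 2)
         else if 2 * g < j - a - s0 + 2 then 2 * (x - 1) * x ^ (j - 1 - (j - a - s0) / 2) else 0)) else 0)
    (hvGen : ∀ j a, (a ≤ m ∧ (j + a ≤ m ∨ (2 * a ≤ m ∧ j + a ≤ jl))) → vP j a = nP j a ∧ vM j a = nM j a)
    (hvOff : ∀ j a, ¬ (a ≤ m ∧ (j + a ≤ m ∨ (2 * a ≤ m ∧ j + a ≤ jl))) → j + m ≠ jl + a → vP j a = 0 ∧ vM j a = 0)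
    (hvTop : ∀ j a, ¬ (a ≤ m ∧ (j + a ≤ m ∨ (2 * a ≤ m ∧ j + a ≤ jl))) → j + m = jl + a →
      (vP j a = if 2 * j + (g + s0) ≤ 2 * jl + 1 ∧ (j + a + 2 ≤ m + s0 + 2 * g ∨ ε = 1) then
          (if j + a < m + s0 then x ^ j else (if 2 * g ≤ j + a - m - s0 + 1 then 2 else 1) * x ^ (j - (j + a - m - s0 + 1) / 2)) else 0) ∧
      (vM j a = if 2 * j + (g + s0) ≤ 2 * jl + 1 ∧ (j + a + 2 ≤ m + s0 + 2 * g ∨ ε = -1) then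
          (if j + a < m + s0 then x ^ j else (if 2 * g ≤ j + a - m - s0 + 1 then 2 else 1) * x ^ (j - (j + a - m - s0 + 1) / 2)) else 0))
    {a : ℕ} (ha : 1 ≤ a) (j : ℕ) :
    x ^ a * (vP j a - vM j a) =
      (if a + s0 ≤ j ∧ (j - (a + s0)) % 2 = 0 then
        (if (a ≤ m ∧ (j + a ≤ m ∨ (2 * a ≤ m ∧ j + a ≤ jl))) then
          x ^ a * (if j - a - s0 + 2 = 2 * g then -2 * x ^ (j - 1 - (j - a - s0) / 2) else if 2 * g < j - a - s0 + 2 then 2 * (x - 1) * x ^ (j - 1 - (j - a - s0) / 2) else 0)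
        else 0) else 0) +
      (if j + m = jl + a then
        ε * (if ¬ (a ≤ m ∧ (j + a ≤ m ∨ (2 * a ≤ m ∧ j + a ≤ jl))) ∧ 2 * j + (g + s0) ≤ 2 * jl + 1 ∧ ¬ (j + a + 2 ≤ m + s0 + 2 * g) then 2 * x ^ ((jl + s0) / 2 + a) else 0)
       else 0) := by
  have ha0 : a ≠ 0 := by omega
  by_cases hg' : a ≤ m ∧ (j + a ≤ m ∨ (2 * a ≤ m ∧ j + a ≤ jl))
  · -- a generic cell: the u-free difference
    obtain ⟨hP, hM⟩ := hvGen j a hg'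
    have h2 : (if j + m = jl + a then
        ε * (if ¬ (a ≤ m ∧ (j + a ≤ m ∨ (2 * a ≤ m ∧ j + a ≤ jl))) ∧ 2 * j + (g + s0) ≤ 2 * jl + 1 ∧ ¬ (j + a + 2 ≤ m + s0 + 2 * g) then 2 * x ^ ((jl + s0) / 2 + a) else 0)
       else 0) = 0 := by
      rw [if_neg (show ¬ (¬ (a ≤ m ∧ (j + a ≤ m ∨ (2 * a ≤ m ∧ j + a ≤ jl))) ∧ 2 * j + (g + s0) ≤ 2 * jl + 1 ∧ ¬ (j + a + 2 ≤ m + s0 + 2 * g)) from fun h => h.1 hg'),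
        mul_zero, ite_self]
    rw [h2, add_zero, hP, hM, hδ, if_neg ha0]
    by_cases hpar : a + s0 ≤ j ∧ (j - (a + s0)) % 2 = 0
    · rw [if_pos hpar, if_pos hpar, if_pos hg']
    · rw [if_neg hpar, if_neg hpar, mul_zero]
  · have h1 : (if a + s0 ≤ j ∧ (j - (a + s0)) % 2 = 0 then
        (if (a ≤ m ∧ (j + a ≤ m ∨ (2 * a ≤ m ∧ j + a ≤ jl))) then
          x ^ a * (if j - a - s0 + 2 = 2 * g then -2 * x ^ (j - 1 - (j - a - s0) / 2) else if 2 * g < j - a - s0 + 2 then 2 * (x - 1) * x ^ (j - 1 - (j - a - s0) / 2) else 0)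
        else 0) else 0) = 0 := by
      rw [if_neg hg', ite_self]
    rw [h1, zero_add]
    by_cases hdiag : j + m = jl + a
    · -- the diagonal top cell
      obtain ⟨hP, hM⟩ := hvTop j a hg' hdiag
      rw [if_pos hdiag]
      by_cases hi : 2 * j + (g + s0) ≤ 2 * jl + 1
      · by_cases hsmall : j + a + 2 ≤ m + s0 + 2 * g
        · -- both sides alive: they cancel
          have e : vP j a = vM j a := by
            rw [hP, hM, if_pos (And.intro hi (Or.inl hsmall) : 2 * j + (g + s0) ≤ 2 * jl + 1 ∧ (j + a + 2 ≤ m + s0 + 2 * g ∨ ε = 1)),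
              if_pos (And.intro hi (Or.inl hsmall) : 2 * j + (g + s0) ≤ 2 * jl + 1 ∧ (j + a + 2 ≤ m + s0 + 2 * g ∨ ε = -1))]
          rw [e, sub_self, mul_zero,
            if_neg (show ¬ (¬ (a ≤ m ∧ (j + a ≤ m ∨ (2 * a ≤ m ∧ j + a ≤ jl))) ∧ 2 * j + (g + s0) ≤ 2 * jl + 1 ∧ ¬ (j + a + 2 ≤ m + s0 + 2 * g)) from
              fun h => h.2.2 hsmall), mul_zero]
        · -- only the ε-side is alive
          have he : a + (j - (j + a - m - s0 + 1) / 2) = (jl + s0) / 2 + a := by omega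
          have eT : x ^ a * (if j + a < m + s0 then x ^ j else (if 2 * g ≤ j + a - m - s0 + 1 then (2 : ℚ) else 1) * x ^ (j - (j + a - m - s0 + 1) / 2)) =
              2 * x ^ ((jl + s0) / 2 + a) := by
            rw [if_neg (show ¬ j + a < m + s0 by omega), if_pos (show 2 * g ≤ j + a - m - s0 + 1 by omega), ← he, pow_add]; ring
          rw [if_pos (show ¬ (a ≤ m ∧ (j + a ≤ m ∨ (2 * a ≤ m ∧ j + a ≤ jl))) ∧ 2 * j + (g + s0) ≤ 2 * jl + 1 ∧ ¬ (j + a + 2 ≤ m + s0 + 2 * g) from ⟨hg', hi, hsmall⟩)]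
          rcases hε with rfl | rfl
          · have eP : vP j a = (if j + a < m + s0 then x ^ j else (if 2 * g ≤ j + a - m - s0 + 1 then (2 : ℚ) else 1) * x ^ (j - (j + a - m - s0 + 1) / 2)) := by
              rw [hP, if_pos (And.intro hi (Or.inr rfl) : 2 * j + (g + s0) ≤ 2 * jl + 1 ∧ (j + a + 2 ≤ m + s0 + 2 * g ∨ (1 : ℚ) = 1))]
            have eM : vM j a = 0 := by
              rw [hM, if_neg (show ¬ (2 * j + (g + s0) ≤ 2 * jl + 1 ∧ (j + a + 2 ≤ m + s0 + 2 * g ∨ (1 : ℚ) = -1)) from fun h => h.2.elim hsmall (by norm_num))]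
            rw [eP, eM, sub_zero, eT, one_mul]
          · have eP : vP j a = 0 := by
              rw [hP, if_neg (show ¬ (2 * j + (g + s0) ≤ 2 * jl + 1 ∧ (j + a + 2 ≤ m + s0 + 2 * g ∨ (-1 : ℚ) = 1)) from fun h => h.2.elim hsmall (by norm_num))]
            have eM : vM j a = (if j + a < m + s0 then x ^ j else (if 2 * g ≤ j + a - m - s0 + 1 then (2 : ℚ) else 1) * x ^ (j - (j + a - m - s0 + 1) / 2)) := by
              rw [hM, if_pos (And.intro hi (Or.inr rfl) : 2 * j + (g + s0) ≤ 2 * jl + 1 ∧ (j + a + 2 ≤ m + s0 + 2 * g ∨ (-1 : ℚ) = -1))]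
            rw [eP, eM, zero_sub, mul_neg, eT]; ring
      · have eP : vP j a = 0 := by rw [hP, if_neg (show ¬ (2 * j + (g + s0) ≤ 2 * jl + 1 ∧ (j + a + 2 ≤ m + s0 + 2 * g ∨ ε = 1)) from fun h => hi h.1)]
        have eM : vM j a = 0 := by rw [hM, if_neg (show ¬ (2 * j + (g + s0) ≤ 2 * jl + 1 ∧ (j + a + 2 ≤ m + s0 + 2 * g ∨ ε = -1)) from fun h => hi h.1)]
        rw [eP, eM, sub_self, mul_zero,
          if_neg (show ¬ (¬ (a ≤ m ∧ (j + a ≤ m ∨ (2 * a ≤ m ∧ j + a ≤ jl))) ∧ 2 * j + (g + s0) ≤ 2 * jl + 1 ∧ ¬ (j + a + 2 ≤ m + s0 + 2 * g)) from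
            fun h => hi h.2.1), mul_zero]
    · -- off the diagonal and not generic: empty
      obtain ⟨hP, hM⟩ := hvOff j a hg' hdiag
      rw [hP, hM, sub_self, mul_zero, if_neg hdiag]

/-- **THE COLUMN `a ≥ 1`** of the RamM difference census: the generic cells live on the ray `j = a + s0 + 2k` (`k` the K♮-level), `2a + s0 + 2k ≤ jl` (alive iff `2a ≤ m`), where
`x^a·(n₊ − n₋)` is `−2x^{2a+s0+g−2}` at `k = g − 1` and `2(x−1)x^{2a+s0+k−1}` for `k ≥ g` — a geometric block worth `2x^{⌊(jl+s0)∕2⌋+a} − 2(x+1)x^{2a+(g+s0)−2}` when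
`2g + 2a + s0 ≤ jl + 2`; the diagonal top cell adds `ε·2x^{⌊(jl+s0)∕2⌋+a}` when `m < 2a`, `2a + (g+s0) ≤ 2m + 1` and `2m + 2g + s0 ≤ jl + 2a + 1`. [folklore] -/
theorem col_pos_ramM (x ε : ℚ) (hε : ε = 1 ∨ ε = -1) {g s0 jl m : ℕ} (hg : 1 ≤ g) (hm : m ≤ jl) (nP nM vP vM : ℕ → ℕ → ℚ)
    (hδ : ∀ j a, nP j a - nM j a = if a + s0 ≤ j ∧ (j - (a + s0)) % 2 = 0 then
      (if a = 0 then (if 2 * g ≤ j - s0 then 2 * x ^ (j - (j - s0) / 2) else 0)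
       else (if j - a - s0 + 2 = 2 * g then -2 * x ^ (j - 1 - (j - a - s0) / 2)
         else if 2 * g < j - a - s0 + 2 then 2 * (x - 1) * x ^ (j - 1 - (j - a - s0) / 2) else 0)) else 0)
    (hvGen : ∀ j a, (a ≤ m ∧ (j + a ≤ m ∨ (2 * a ≤ m ∧ j + a ≤ jl))) → vP j a = nP j a ∧ vM j a = nM j a)
    (hvOff : ∀ j a, ¬ (a ≤ m ∧ (j + a ≤ m ∨ (2 * a ≤ m ∧ j + a ≤ jl))) → j + m ≠ jl + a → vP j a = 0 ∧ vM j a = 0)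
    (hvTop : ∀ j a, ¬ (a ≤ m ∧ (j + a ≤ m ∨ (2 * a ≤ m ∧ j + a ≤ jl))) → j + m = jl + a →
      (vP j a = if 2 * j + (g + s0) ≤ 2 * jl + 1 ∧ (j + a + 2 ≤ m + s0 + 2 * g ∨ ε = 1) then
          (if j + a < m + s0 then x ^ j else (if 2 * g ≤ j + a - m - s0 + 1 then 2 else 1) * x ^ (j - (j + a - m - s0 + 1) / 2)) else 0) ∧
      (vM j a = if 2 * j + (g + s0) ≤ 2 * jl + 1 ∧ (j + a + 2 ≤ m + s0 + 2 * g ∨ ε = -1) then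
          (if j + a < m + s0 then x ^ j else (if 2 * g ≤ j + a - m - s0 + 1 then 2 else 1) * x ^ (j - (j + a - m - s0 + 1) / 2)) else 0))
    {a : ℕ} (ha : 1 ≤ a) :
    ∑ j ∈ range (jl + 1), x ^ a * (vP j a - vM j a) =
      (if 2 * a ≤ m ∧ 2 * g + 2 * a + s0 ≤ jl + 2 then 2 * x ^ ((jl + s0) / 2 + a) - 2 * (x + 1) * x ^ (2 * a + (g + s0) - 2) else 0) +
      ε * (if m < 2 * a ∧ 2 * a + (g + s0) ≤ 2 * m + 1 ∧ 2 * m + 2 * g + s0 ≤ jl + 2 * a + 1 then 2 * x ^ ((jl + s0) / 2 + a) else 0) := by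
  rw [Finset.sum_congr rfl (fun j _ => cell_pos_ramM x ε hε hg hm nP nM vP vM hδ hvGen hvOff hvTop ha j), Finset.sum_add_distrib]
  congr 1
  · ------------------------------------------------------------------ the generic cells on the ray `j = a + s0 + 2k`
    rw [sum_range_parity_reindex (fun j => if (a ≤ m ∧ (j + a ≤ m ∨ (2 * a ≤ m ∧ j + a ≤ jl))) then
        x ^ a * (if j - a - s0 + 2 = 2 * g then -2 * x ^ (j - 1 - (j - a - s0) / 2) else if 2 * g < j - a - s0 + 2 then 2 * (x - 1) * x ^ (j - 1 - (j - a - s0) / 2) else 0)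
        else 0) (a + s0) jl]
    by_cases h2a : 2 * a ≤ m
    · -- the ray cells `2a + s0 + 2k ≤ jl`: `k = g − 1` and the window `g ≤ k`
      have hk : ∀ k ∈ range ((jl + 2 - (a + s0)) / 2),
          (if (a ≤ m ∧ (a + s0 + 2 * k + a ≤ m ∨ (2 * a ≤ m ∧ a + s0 + 2 * k + a ≤ jl))) then
            x ^ a * (if a + s0 + 2 * k - a - s0 + 2 = 2 * g then -2 * x ^ (a + s0 + 2 * k - 1 - (a + s0 + 2 * k - a - s0) / 2)
              else if 2 * g < a + s0 + 2 * k - a - s0 + 2 then 2 * (x - 1) * x ^ (a + s0 + 2 * k - 1 - (a + s0 + 2 * k - a - s0) / 2) else 0) else 0) =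
          (if k = g - 1 then (if 2 * g + 2 * a + s0 ≤ jl + 2 then -2 * x ^ (2 * a + (g + s0) - 2) else 0) else 0) +
          (if g ≤ k ∧ k < g + (jl + 2 - (2 * a + s0 + 2 * g)) / 2 then 2 * (x - 1) * x ^ (2 * a + s0 + k - 1) else 0) := by
        intro k _
        rw [show a + s0 + 2 * k - a - s0 = 2 * k by omega]
        by_cases hK : 2 * a + s0 + 2 * k ≤ jl
        · rw [if_pos (show (a ≤ m ∧ (a + s0 + 2 * k + a ≤ m ∨ (2 * a ≤ m ∧ a + s0 + 2 * k + a ≤ jl))) by omega)]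
          by_cases hk1 : k = g - 1
          · rw [if_pos (show 2 * k + 2 = 2 * g by omega), if_pos hk1, if_pos (show 2 * g + 2 * a + s0 ≤ jl + 2 by omega), if_neg (by omega), add_zero,
              show a + s0 + 2 * k - 1 - 2 * k / 2 = a + (g + s0) - 2 by omega, ← mul_assoc, mul_comm (x ^ a), mul_assoc, ← pow_add,
              show a + (a + (g + s0) - 2) = 2 * a + (g + s0) - 2 by omega]
          · rw [if_neg (show ¬ 2 * k + 2 = 2 * g by omega), if_neg hk1, zero_add]
            by_cases hkd : g ≤ k
            · rw [if_pos (show 2 * g < 2 * k + 2 by omega), if_pos (show g ≤ k ∧ k < g + (jl + 2 - (2 * a + s0 + 2 * g)) / 2 by omega),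
                show a + s0 + 2 * k - 1 - 2 * k / 2 = a + s0 + k - 1 by omega, ← mul_assoc, mul_comm (x ^ a), mul_assoc, ← pow_add,
                show a + (a + s0 + k - 1) = 2 * a + s0 + k - 1 by omega]
            · rw [if_neg (show ¬ 2 * g < 2 * k + 2 by omega), mul_zero, if_neg (show ¬ (g ≤ k ∧ k < g + (jl + 2 - (2 * a + s0 + 2 * g)) / 2) by omega)]
        · rw [if_neg (show ¬ ((a ≤ m ∧ (a + s0 + 2 * k + a ≤ m ∨ (2 * a ≤ m ∧ a + s0 + 2 * k + a ≤ jl)))) by omega),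
            if_neg (show ¬ (g ≤ k ∧ k < g + (jl + 2 - (2 * a + s0 + 2 * g)) / 2) by omega), add_zero]
          by_cases hk1 : k = g - 1
          · rw [if_pos hk1, if_neg (show ¬ 2 * g + 2 * a + s0 ≤ jl + 2 by omega)]
          · rw [if_neg hk1]
      rw [Finset.sum_congr rfl hk, Finset.sum_add_distrib, Finset.sum_ite_eq' (range ((jl + 2 - (a + s0)) / 2))]
      by_cases hwin : 2 * g + 2 * a + s0 ≤ jl + 2
      · rw [if_pos (Finset.mem_range.2 (show g - 1 < (jl + 2 - (a + s0)) / 2 by omega)), if_pos hwin, if_pos (show 2 * a ≤ m ∧ 2 * g + 2 * a + s0 ≤ jl + 2 from ⟨h2a, hwin⟩),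
          sum_range_window_reindex (fun k => 2 * (x - 1) * x ^ (2 * a + s0 + k - 1)) (show g + (jl + 2 - (2 * a + s0 + 2 * g)) / 2 ≤ (jl + 2 - (a + s0)) / 2 by omega)]
        have hw : ∑ i ∈ range ((jl + 2 - (2 * a + s0 + 2 * g)) / 2), 2 * (x - 1) * x ^ (2 * a + s0 + (g + i) - 1) =
            2 * x ^ (2 * a + s0 + g - 1) * ((x - 1) * ∑ i ∈ range ((jl + 2 - (2 * a + s0 + 2 * g)) / 2), x ^ i) := by
          rw [Finset.mul_sum, Finset.mul_sum]
          refine Finset.sum_congr rfl fun i _ => ?_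
          rw [show 2 * a + s0 + (g + i) - 1 = (2 * a + s0 + g - 1) + i by omega, pow_add]; ring
        rw [hw, geom_sum_mul', ← sub_eq_zero]
        have e1 : x ^ ((jl + s0) / 2 + a) = x ^ (2 * a + s0 + g - 1) * x ^ ((jl + 2 - (2 * a + s0 + 2 * g)) / 2) := by rw [← pow_add]; congr 1; omega
        have e2 : x ^ (2 * a + s0 + g - 1) = x ^ (2 * a + (g + s0) - 2) * x := by rw [← pow_succ]; congr 1; omega
        rw [e1, e2]; ring
      · rw [if_neg hwin, ite_self, zero_add, if_neg (show ¬ (2 * a ≤ m ∧ 2 * g + 2 * a + s0 ≤ jl + 2) from fun h => hwin h.2)]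
        refine Finset.sum_eq_zero fun k _ => ?_
        rw [if_neg (show ¬ (g ≤ k ∧ k < g + (jl + 2 - (2 * a + s0 + 2 * g)) / 2) by omega)]
    · -- `2a > m`: no generic cell above `a` on this column
      rw [if_neg (show ¬ (2 * a ≤ m ∧ 2 * g + 2 * a + s0 ≤ jl + 2) from fun h => h2a h.1)]
      refine Finset.sum_eq_zero fun k _ => ?_
      rw [if_neg (show ¬ ((a ≤ m ∧ (a + s0 + 2 * k + a ≤ m ∨ (2 * a ≤ m ∧ a + s0 + 2 * k + a ≤ jl)))) by omega)]
  · ------------------------------------------------------------------ the diagonal top cell `j = jl + a − m`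
    have hiff : ∀ j ∈ range (jl + 1),
        (if j + m = jl + a then ε * (if ¬ (a ≤ m ∧ (j + a ≤ m ∨ (2 * a ≤ m ∧ j + a ≤ jl))) ∧ 2 * j + (g + s0) ≤ 2 * jl + 1 ∧ ¬ (j + a + 2 ≤ m + s0 + 2 * g) then
          2 * x ^ ((jl + s0) / 2 + a) else 0) else 0) =
        (if j = jl + a - m then ε * (if ¬ (a ≤ m ∧ (j + a ≤ m ∨ (2 * a ≤ m ∧ j + a ≤ jl))) ∧ 2 * j + (g + s0) ≤ 2 * jl + 1 ∧ ¬ (j + a + 2 ≤ m + s0 + 2 * g) then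
          2 * x ^ ((jl + s0) / 2 + a) else 0) else 0) := by
      intro j _
      by_cases h : j + m = jl + a
      · rw [if_pos h, if_pos (show j = jl + a - m by omega)]
      · rw [if_neg h, if_neg (show j ≠ jl + a - m by omega)]
    rw [Finset.sum_congr rfl hiff, Finset.sum_ite_eq' (range (jl + 1))]
    by_cases htop : m < 2 * a ∧ 2 * a + (g + s0) ≤ 2 * m + 1 ∧ 2 * m + 2 * g + s0 ≤ jl + 2 * a + 1
    · rw [if_pos htop, if_pos (Finset.mem_range.2 (show jl + a - m < jl + 1 by omega))]
      congr 1
      rw [if_pos]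
      refine ⟨fun h => ?_, ?_, fun h => ?_⟩ <;> omega
    · rw [if_neg htop, mul_zero]
      by_cases hmem : jl + a - m ∈ range (jl + 1)
      · rw [if_pos hmem, if_neg, mul_zero]
        rw [Finset.mem_range] at hmem
        intro h
        apply htop
        obtain ⟨h1, h2, h3⟩ := h
        refine ⟨?_, ?_, ?_⟩ <;> omega
      · rw [if_neg hmem]

end Summit.HodgeConjecture.HodgeConjecture.Cruxes.H413.F0P3cDyRamToricCensusSumRamMParts
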